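import Summits.Ventures.Crystal3D.Theorems.StickyWulffConstantPolycrystalWulffBoundWulffHRepDefs
import Summits.Ventures.Crystal3D.Theorems.StickyWulffConstantPolycrystalWulffBoundHyperplaneNull
import Mathlib.Analysis.InnerProductSpace.Projection.Reflection

/-!
# `PolycrystalWulffBound`: the two cells of the COHERENT CENTRAL TWIN `E₀` — the upper half `T` of the
# cubic Wulff body and its mirror image `T' = R T` in the basal plane — as explicit `H`-polytopes
# (crux `stmt-Ventures-19482` / `23911`; second brick of the kernel E₀-equality, memo P-TWIN-g16 §2)

Route `StickyWulffConstant` of the venture `Summits/Ventures/Crystal3D`, second prover lane (poly-p2,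
gen 16).  With the hexagonal axis `m = (1,1,1)/√3 = twinAxis` of `W_cubic` and the basal mirror
`R = reflection in m^⊥`:
* `topHalfHRep = insert (−m, 0) wulffHRep`, `T = polytope topHalfHRep = W°_cubic ∩ {⟪m,x⟫ > 0}`:
  bounded, nonempty, unit normals, pairwise distinct facet planes, `0 ∈ closure T ⊆ W_cubic`,
  `closure T ⊆ {⟪m,x⟫ ≥ 0}`;
* `botHalfHRep = insert (m, 0) (R-image of wulffHRep)`, `polytope botHalfHRep = R '' T`;
* `T` and `R '' T` are disjoint, their closures meet inside the basal plane, and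
  `closure T ∩ closure (R '' T) = closure T ∩ {⟪−m, x⟫ = 0}`;
* volumes: `|T| = |R '' T| = 16`, `|T ∪ R '' T| = 32`.
These are the hypotheses of clauses (A)/(B) of `PolytopeCalculus` for the pair `(T, R T)`; the energy
identity `F(E₀) = 96` is the next brick.
WHAT THIS IS NOT: any facet area or energy; the crux is not claimed.
-/

noncomputable section

open scoped BigOperators InnerProductSpace ENNReal
open MeasureTheory Set

namespace Summit.Ventures.Crystal3D.Theorems

open Summit.Ventures.Crystal3D.Cruxes.TextureLiminf.TexShadow (E3 polytope supportFn)

open Literature.MathematicalPhysics.StatisticalMechanics (fccWulffBody mem_fccWulffBody_iff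
  isCompact_fccWulffBody volume_fccWulffBody convex_fccWulffBody)

/-! ### The twin axis and the two `H`-representations -/

/-- The hexagonal (twin) axis `m = (1,1,1)/√3` of the cubic Wulff body. -/
def twinAxis : E3 := wulffHexNormal (fun _ => true)

/-- `H`-representation of the upper half `T = W°_cubic ∩ {⟪m, x⟫ > 0}`. -/
def topHalfHRep : Finset (E3 × ℝ) := insert (-twinAxis, (0 : ℝ)) wulffHRep

/-- `H`-representation of the mirror image `R T` (`R` = reflection in `m^⊥`). -/
def botHalfHRep : Finset (E3 × ℝ) :=
  insert (twinAxis, (0 : ℝ)) (wulffHRep.image fun p => ((ℝ ∙ twinAxis)ᗮ.reflection p.1, p.2))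

/-- `‖m‖ = 1`. -/
theorem norm_twinAxis : ‖twinAxis‖ = 1 := norm_wulffHexNormal _

/-- `m ≠ 0`. -/
theorem twinAxis_ne_zero : twinAxis ≠ 0 := by
  intro h; have := norm_twinAxis; rw [h, norm_zero] at this; exact zero_ne_one this

/-- `−(±1,±1,±1)/√3 = (∓1,∓1,∓1)/√3`. -/
theorem neg_wulffHexNormal (σ : Fin 3 → Bool) : -wulffHexNormal σ = wulffHexNormal (fun i => !σ i) := by
  ext i
  show -(if σ i then (Real.sqrt 3)⁻¹ else -(Real.sqrt 3)⁻¹) = if (!σ i) then (Real.sqrt 3)⁻¹ else -(Real.sqrt 3)⁻¹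
  cases σ i <;> simp

/-- `−(±e_i) = ∓e_i`. -/
theorem neg_wulffSqNormal (i : Fin 3) (b : Bool) : -wulffSqNormal (i, b) = wulffSqNormal (i, !b) := by
  ext j
  by_cases h : j = i
  · subst h; cases b <;> simp [wulffSqNormal]
  · cases b <;> simp [wulffSqNormal, h]

/-- `(m, √3) ∈ wulffHRep`. -/
theorem twinAxis_mem_wulffHRep : (twinAxis, Real.sqrt 3) ∈ wulffHRep :=
  (mem_wulffHRep_iff _).2 (Or.inr ⟨fun _ => true, rfl⟩)

/-- `(−m, √3) ∈ wulffHRep`. -/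
theorem neg_twinAxis_mem_wulffHRep : (-twinAxis, Real.sqrt 3) ∈ wulffHRep :=
  (mem_wulffHRep_iff _).2 (Or.inr ⟨fun _ => false, by rw [twinAxis, neg_wulffHexNormal]; rfl⟩)

/-- `wulffHRep` is symmetric: with `(n, b)` it contains `(−n, b)`. -/
theorem neg_mem_wulffHRep {p : E3 × ℝ} (hp : p ∈ wulffHRep) : (-p.1, p.2) ∈ wulffHRep := by
  rcases (mem_wulffHRep_iff p).1 hp with ⟨⟨i, b⟩, rfl⟩ | ⟨σ, rfl⟩
  · exact (mem_wulffHRep_iff _).2 (Or.inl ⟨(i, !b), by rw [neg_wulffSqNormal]⟩)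
  · exact (mem_wulffHRep_iff _).2 (Or.inr ⟨fun i => !σ i, by rw [neg_wulffHexNormal]⟩)

/-- `h_W(m) = √3` and `h_W(−m) = √3`. -/
theorem supportFn_fccWulffBody_twinAxis :
    supportFn fccWulffBody twinAxis = Real.sqrt 3 ∧ supportFn fccWulffBody (-twinAxis) = Real.sqrt 3 :=
  ⟨supportFn_fccWulffBody_eq _ twinAxis_mem_wulffHRep,
    supportFn_fccWulffBody_eq _ neg_twinAxis_mem_wulffHRep⟩

/-! ### The upper half `T` -/

/-- `polytope (insert c H) = {⟪c.1, x⟫ < c.2} ∩ polytope H`. -/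
theorem polytope_insert (c : E3 × ℝ) (H : Finset (E3 × ℝ)) :
    polytope (insert c H) = {x | ⟪c.1, x⟫_ℝ < c.2} ∩ polytope H := by
  ext x; simp [polytope]

/-- `T = {0 < ⟪m, x⟫} ∩ W°`. -/
theorem polytope_topHalfHRep_eq :
    polytope topHalfHRep = {x : E3 | 0 < ⟪twinAxis, x⟫_ℝ} ∩ polytope wulffHRep := by
  rw [topHalfHRep, polytope_insert]
  congr 1
  ext x
  simp only [mem_setOf_eq, inner_neg_left, neg_lt_zero]

/-- `(−m, 0) ∉ wulffHRep` (its levels are positive). -/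
theorem neg_twinAxis_zero_notMem : (-twinAxis, (0 : ℝ)) ∉ wulffHRep := fun h => by
  have := wulffHRep_snd_pos _ h; simp at this

/-- `(m, 0) ∉` the `R`-image of `wulffHRep`. -/
theorem twinAxis_zero_notMem_image :
    (twinAxis, (0 : ℝ)) ∉ wulffHRep.image fun p => ((ℝ ∙ twinAxis)ᗮ.reflection p.1, p.2) := by
  intro h
  obtain ⟨p, hp, hpe⟩ := Finset.mem_image.1 h
  have h2 : p.2 = 0 := (Prod.ext_iff.1 hpe).2
  have := wulffHRep_snd_pos p hp
  rw [h2] at this; exact lt_irrefl _ this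

/-- `T ⊆ W°_cubic`. -/
theorem polytope_topHalfHRep_subset : polytope topHalfHRep ⊆ polytope wulffHRep := by
  rw [polytope_topHalfHRep_eq]; exact inter_subset_right

/-- `T` is bounded. -/
theorem isBounded_polytope_topHalfHRep : Bornology.IsBounded (polytope topHalfHRep) :=
  isBounded_polytope_wulffHRep.subset polytope_topHalfHRep_subset

/-- `m/2 ∈ T`: the upper half is nonempty. -/
theorem half_twinAxis_mem : (1 / 2 : ℝ) • twinAxis ∈ polytope topHalfHRep := by
  rw [polytope_topHalfHRep_eq]
  have hmm : ⟪twinAxis, twinAxis⟫_ℝ = 1 := by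
    rw [real_inner_self_eq_norm_sq, norm_twinAxis, one_pow]
  refine ⟨?_, ?_⟩
  · show 0 < ⟪twinAxis, (1 / 2 : ℝ) • twinAxis⟫_ℝ
    rw [inner_smul_right, hmm]; norm_num
  · simp only [polytope, mem_iInter, mem_setOf_eq]
    intro p hp
    have h1 : ⟪p.1, (1 / 2 : ℝ) • twinAxis⟫_ℝ ≤ ‖p.1‖ * ‖(1 / 2 : ℝ) • twinAxis‖ :=
      real_inner_le_norm _ _
    rw [wulffHRep_norm_eq_one p hp, norm_smul, norm_twinAxis, one_mul, mul_one,
      Real.norm_of_nonneg (by norm_num : (0:ℝ) ≤ 1 / 2)] at h1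
    have h2 : (1 / 2 : ℝ) < p.2 := by
      rcases (mem_wulffHRep_iff p).1 hp with ⟨ib, rfl⟩ | ⟨σ, rfl⟩
      · norm_num
      · show (1 / 2 : ℝ) < Real.sqrt 3
        rw [show (1 / 2 : ℝ) = Real.sqrt (1 / 4) by
          rw [show (1 / 4 : ℝ) = (1 / 2) ^ 2 by norm_num, Real.sqrt_sq (by norm_num)]]
        exact Real.sqrt_lt_sqrt (by norm_num) (by norm_num)
    linarith

/-- The upper half is nonempty. -/
theorem polytope_topHalfHRep_nonempty : (polytope topHalfHRep).Nonempty := ⟨_, half_twinAxis_mem⟩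

/-- Unit normals of `topHalfHRep`. -/
theorem topHalfHRep_norm_eq_one : ∀ p ∈ topHalfHRep, ‖p.1‖ = 1 := by
  intro p hp
  rcases Finset.mem_insert.1 hp with rfl | hp
  · show ‖-twinAxis‖ = 1; rw [norm_neg, norm_twinAxis]
  · exact wulffHRep_norm_eq_one p hp

/-- The facet planes of `topHalfHRep` are pairwise distinct. -/
theorem topHalfHRep_planes_ne : ∀ p ∈ topHalfHRep, ∀ p' ∈ topHalfHRep, p ≠ p' →
    {x : E3 | ⟪p.1, x⟫_ℝ = p.2} ≠ {x : E3 | ⟪p'.1, x⟫_ℝ = p'.2} := by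
  -- the cut plane contains `0`, the facet planes of `W` do not
  have hcut : ∀ q ∈ wulffHRep, {x : E3 | ⟪(-twinAxis, (0:ℝ)).1, x⟫_ℝ = (-twinAxis, (0:ℝ)).2} ≠
      {x : E3 | ⟪q.1, x⟫_ℝ = q.2} := by
    intro q hq heq
    have h0 : (0 : E3) ∈ {x : E3 | ⟪(-twinAxis, (0:ℝ)).1, x⟫_ℝ = (-twinAxis, (0:ℝ)).2} := by
      simp
    rw [heq] at h0
    have : (0 : ℝ) = q.2 := by simpa using h0
    exact (wulffHRep_snd_pos q hq).ne this
  intro p hp p' hp' hne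
  rcases Finset.mem_insert.1 hp with rfl | hp
  · rcases Finset.mem_insert.1 hp' with rfl | hp'
    · exact absurd rfl hne
    · exact hcut p' hp'
  · rcases Finset.mem_insert.1 hp' with rfl | hp'
    · exact (hcut p hp).symm
    · exact wulffHRep_planes_ne p hp p' hp' hne

/-- `closure T = {⟪m,x⟫ ≥ 0} ∩ (closed polytope)`: the closed form. -/
theorem closure_polytope_topHalfHRep :
    closure (polytope topHalfHRep) = {x : E3 | ∀ p ∈ topHalfHRep, ⟪p.1, x⟫_ℝ ≤ p.2} := by
  have h := Literature.Analysis.Convexity.closure_openHPolytope_eq topHalfHRep polytope_topHalfHRep_nonempty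
  simpa only [polytope, Set.ext_iff, mem_iInter, mem_setOf_eq] using h

/-- `closure T ⊆ W_cubic`. -/
theorem closure_topHalf_subset_fccWulffBody : closure (polytope topHalfHRep) ⊆ fccWulffBody := by
  rw [← closure_polytope_wulffHRep]
  exact closure_mono polytope_topHalfHRep_subset

/-- `closure T ⊆ {⟪m, x⟫ ≥ 0}`. -/
theorem closure_topHalf_subset_halfspace :
    closure (polytope topHalfHRep) ⊆ {x : E3 | 0 ≤ ⟪twinAxis, x⟫_ℝ} := by
  rw [closure_polytope_topHalfHRep]
  intro x hx
  have := hx (-twinAxis, 0) (Finset.mem_insert_self _ _)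
  simp only [inner_neg_left, neg_le, neg_zero] at this
  exact this

/-- `0 ∈ closure T`. -/
theorem zero_mem_closure_topHalf : (0 : E3) ∈ closure (polytope topHalfHRep) := by
  rw [closure_polytope_topHalfHRep]
  intro p hp
  rw [inner_zero_right]
  rcases Finset.mem_insert.1 hp with rfl | hp
  · exact le_rfl
  · exact (wulffHRep_snd_pos p hp).le

/-- `closure T` is compact and convex. -/
theorem isCompact_closure_topHalf : IsCompact (closure (polytope topHalfHRep)) :=
  Metric.isCompact_of_isClosed_isBounded isClosed_closure isBounded_polytope_topHalfHRep.closure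

/-- An open `H`-polytope is convex (route spelling). -/
theorem convex_polytope (H : Finset (E3 × ℝ)) : Convex ℝ (polytope H) :=
  Literature.Analysis.Convexity.convex_openHPolytope H

/-! ### The mirror `R` and the lower cell `R T` -/

/-- `R m = −m`. -/
theorem reflection_twinAxis : (ℝ ∙ twinAxis)ᗮ.reflection twinAxis = -twinAxis :=
  Submodule.reflection_orthogonalComplement_singleton_eq_neg twinAxis

/-- `R` is self-adjoint: `⟪R a, x⟫ = ⟪a, R x⟫`. -/
theorem inner_reflection_left (a x : E3) :
    ⟪(ℝ ∙ twinAxis)ᗮ.reflection a, x⟫_ℝ = ⟪a, (ℝ ∙ twinAxis)ᗮ.reflection x⟫_ℝ := by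
  conv_lhs => rw [← Submodule.reflection_reflection (ℝ ∙ twinAxis)ᗮ x]
  rw [LinearIsometryEquiv.inner_map_map]

/-- `R` fixes the basal plane pointwise. -/
theorem reflection_eq_self_of_inner_eq_zero {x : E3} (hx : ⟪twinAxis, x⟫_ℝ = 0) :
    (ℝ ∙ twinAxis)ᗮ.reflection x = x :=
  Submodule.reflection_mem_subspace_eq_self (Submodule.mem_orthogonal_singleton_iff_inner_right.2 hx)

/-- `⟪m, R x⟫ = −⟪m, x⟫`. -/
theorem inner_twinAxis_reflection (x : E3) :
    ⟪twinAxis, (ℝ ∙ twinAxis)ᗮ.reflection x⟫_ℝ = -⟪twinAxis, x⟫_ℝ := by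
  rw [← inner_reflection_left, reflection_twinAxis, inner_neg_left]

/-- The lower cell is the mirror image of the upper one: `polytope botHalfHRep = R '' T`. -/
theorem polytope_botHalfHRep_eq :
    polytope botHalfHRep = (ℝ ∙ twinAxis)ᗮ.reflection '' polytope topHalfHRep := by
  set R := (ℝ ∙ twinAxis)ᗮ.reflection with hR
  ext x
  rw [botHalfHRep, polytope_insert, LinearIsometryEquiv.image_eq_preimage_symm, Submodule.reflection_symm,
    mem_preimage, polytope_topHalfHRep_eq]
  simp only [mem_inter_iff, mem_setOf_eq, polytope, mem_iInter, Finset.mem_image]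
  constructor
  · rintro ⟨h0, h⟩
    refine ⟨by rw [inner_twinAxis_reflection]; linarith, fun p hp => ?_⟩
    have := h (R p.1, p.2) ⟨p, hp, rfl⟩
    rwa [inner_reflection_left] at this
  · rintro ⟨h0, h⟩
    refine ⟨by rw [inner_twinAxis_reflection] at h0; linarith, ?_⟩
    rintro q ⟨p, hp, rfl⟩
    show ⟪R p.1, x⟫_ℝ < p.2
    rw [inner_reflection_left]; exact h p hp

/-- `R T ⊆ {⟪m, x⟫ < 0}` and `T ⊆ {⟪m,x⟫ > 0}`: the two cells are disjoint. -/
theorem disjoint_topHalf_reflection :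
    Disjoint (polytope topHalfHRep) ((ℝ ∙ twinAxis)ᗮ.reflection '' polytope topHalfHRep) := by
  rw [Set.disjoint_left]
  rintro x hx ⟨y, hy, rfl⟩
  rw [polytope_topHalfHRep_eq] at hx hy
  have h1 : 0 < ⟪twinAxis, (ℝ ∙ twinAxis)ᗮ.reflection y⟫_ℝ := hx.1
  have h2 : 0 < ⟪twinAxis, y⟫_ℝ := hy.1
  rw [inner_twinAxis_reflection] at h1
  linarith

/-- `closure (R T) = R (closure T) ⊆ {⟪m, x⟫ ≤ 0}`. -/
theorem closure_reflection_subset_halfspace :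
    closure ((ℝ ∙ twinAxis)ᗮ.reflection '' polytope topHalfHRep) ⊆ {x : E3 | ⟪twinAxis, x⟫_ℝ ≤ 0} := by
  have hcl : closure ((ℝ ∙ twinAxis)ᗮ.reflection '' polytope topHalfHRep) =
      (ℝ ∙ twinAxis)ᗮ.reflection '' closure (polytope topHalfHRep) := by
    simpa using (((ℝ ∙ twinAxis)ᗮ.reflection.toHomeomorph).image_closure (polytope topHalfHRep)).symm
  rw [hcl]
  rintro x ⟨y, hy, rfl⟩
  show ⟪twinAxis, (ℝ ∙ twinAxis)ᗮ.reflection y⟫_ℝ ≤ 0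
  rw [inner_twinAxis_reflection, neg_nonpos]
  exact closure_topHalf_subset_halfspace hy

/-- The closures of the two cells meet inside the basal plane `{⟪m, x⟫ = 0}`. -/
theorem closure_inter_closure_subset_plane :
    closure (polytope topHalfHRep) ∩ closure ((ℝ ∙ twinAxis)ᗮ.reflection '' polytope topHalfHRep) ⊆
      {x : E3 | ⟪twinAxis, x⟫_ℝ = 0} := fun _ hx =>
  le_antisymm (closure_reflection_subset_halfspace hx.2) (closure_topHalf_subset_halfspace hx.1)

/-- The common face: `closure T ∩ closure (R T) = closure T ∩ {⟪−m, x⟫ = 0}`. -/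
theorem closure_inter_closure_eq :
    closure (polytope topHalfHRep) ∩ closure ((ℝ ∙ twinAxis)ᗮ.reflection '' polytope topHalfHRep) =
      closure (polytope topHalfHRep) ∩ {x : E3 | ⟪-twinAxis, x⟫_ℝ = 0} := by
  ext x
  constructor
  · intro hx
    refine ⟨hx.1, ?_⟩
    show ⟪-twinAxis, x⟫_ℝ = 0
    rw [inner_neg_left, closure_inter_closure_subset_plane hx, neg_zero]
  · rintro ⟨hx, h0⟩
    have h0' : ⟪twinAxis, x⟫_ℝ = 0 := by
      rw [mem_setOf_eq, inner_neg_left, neg_eq_zero] at h0; exact h0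
    refine ⟨hx, ?_⟩
    have hcl : closure ((ℝ ∙ twinAxis)ᗮ.reflection '' polytope topHalfHRep) =
        (ℝ ∙ twinAxis)ᗮ.reflection '' closure (polytope topHalfHRep) := by
      simpa using (((ℝ ∙ twinAxis)ᗮ.reflection.toHomeomorph).image_closure (polytope topHalfHRep)).symm
    rw [hcl]
    exact ⟨x, hx, reflection_eq_self_of_inner_eq_zero h0'⟩

/-! ### Volumes: `|T| = |R T| = 16`, `|T ∪ R T| = 32` -/

/-- `W°_cubic` is centrally symmetric. -/
theorem neg_mem_polytope_wulffHRep {x : E3} (hx : x ∈ polytope wulffHRep) : -x ∈ polytope wulffHRep := by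
  simp only [polytope, mem_iInter, mem_setOf_eq] at hx ⊢
  intro p hp
  have := hx (-p.1, p.2) (neg_mem_wulffHRep hp)
  simpa [inner_neg_left, inner_neg_right] using this

/-- `|W°_cubic| = 32`. -/
theorem volume_polytope_wulffHRep : volume (polytope wulffHRep) = ENNReal.ofReal 32 := by
  rw [← volume_fccWulffBody, ← closure_polytope_wulffHRep]
  exact ((Literature.Analysis.Convexity.volume_closure_eq_of_convex (convex_polytope _)).1).symm

/-- `|T| = 16`: the two open halves of `W°_cubic` are mirror images under `x ↦ −x` and the basal
section is null. -/
theorem volume_polytope_topHalfHRep : volume (polytope topHalfHRep) = ENNReal.ofReal 16 := by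
  set P := polytope wulffHRep with hP
  set Tp := {x : E3 | 0 < ⟪twinAxis, x⟫_ℝ} ∩ P with hTp
  set Tm := {x : E3 | ⟪twinAxis, x⟫_ℝ < 0} ∩ P with hTm
  set Z := {x : E3 | ⟪twinAxis, x⟫_ℝ = 0} with hZ
  have hmeasP : MeasurableSet P :=
    (Literature.Analysis.Convexity.isOpen_openHPolytope wulffHRep).measurableSet
  have hcont : Continuous fun x : E3 => ⟪twinAxis, x⟫_ℝ := continuous_const.inner continuous_id
  have hTm_meas : MeasurableSet Tm := (isOpen_lt hcont continuous_const).measurableSet.inter hmeasP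
  have hZ0 : volume Z = 0 := volume_setOf_inner_eq_zero twinAxis_ne_zero 0
  -- `Tm = -Tp`
  have hneg : Tm = -Tp := by
    ext x
    simp only [hTm, hTp, Set.mem_neg, mem_inter_iff, mem_setOf_eq, inner_neg_right, neg_pos]
    constructor
    · rintro ⟨h1, h2⟩; exact ⟨h1, by simpa using neg_mem_polytope_wulffHRep h2⟩
    · rintro ⟨h1, h2⟩; exact ⟨h1, by simpa using neg_mem_polytope_wulffHRep h2⟩
  have hvol_eq : volume Tm = volume Tp := by rw [hneg, Measure.measure_neg]
  -- `P ⊆ Tp ∪ Tm ∪ Z` and the pieces are disjoint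
  have hcover : P ⊆ Tp ∪ Tm ∪ Z := by
    intro x hx
    rcases lt_trichotomy 0 (⟪twinAxis, x⟫_ℝ) with h | h | h
    · exact Or.inl (Or.inl ⟨h, hx⟩)
    · exact Or.inr h.symm
    · exact Or.inl (Or.inr ⟨h, hx⟩)
  have hdisj : Disjoint Tp Tm := by
    rw [Set.disjoint_left]
    rintro x ⟨h1, -⟩ ⟨h2, -⟩
    have h1' : 0 < ⟪twinAxis, x⟫_ℝ := h1
    have h2' : ⟪twinAxis, x⟫_ℝ < 0 := h2
    exact lt_asymm h1' h2'
  have hsub : Tp ∪ Tm ⊆ P := union_subset inter_subset_right inter_subset_right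
  have h32 : volume P = ENNReal.ofReal 32 := volume_polytope_wulffHRep
  have hle1 : volume P ≤ volume Tp + volume Tm + volume Z :=
    (measure_mono hcover).trans ((measure_union_le _ _).trans (add_le_add (measure_union_le _ _) le_rfl))
  have hle2 : volume Tp + volume Tm ≤ volume P := by
    rw [← measure_union hdisj hTm_meas]; exact measure_mono hsub
  rw [hZ0, add_zero, hvol_eq, h32] at hle1
  rw [hvol_eq, h32] at hle2
  rw [polytope_topHalfHRep_eq, ← hP, ← hTp]
  have h2 : volume Tp + volume Tp = 2 * volume Tp := (two_mul _).symm
  rw [h2] at hle1 hle2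
  have hfin : volume Tp ≠ ⊤ := by
    intro ht; rw [ht] at hle2; simp at hle2
  have : 2 * volume Tp = ENNReal.ofReal 32 := le_antisymm hle2 hle1
  calc volume Tp = (2 * volume Tp) / 2 := by
          rw [mul_comm, ENNReal.mul_div_cancel_right (by norm_num) (by norm_num)]
    _ = ENNReal.ofReal 32 / 2 := by rw [this]
    _ = ENNReal.ofReal 16 := by
          rw [show (32 : ℝ) = 2 * 16 by norm_num, ENNReal.ofReal_mul (by norm_num), ENNReal.ofReal_ofNat,
            mul_comm, ENNReal.mul_div_cancel_right (by norm_num) (by norm_num)]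

/-- `|R T| = 16`. -/
theorem volume_reflection_topHalf :
    volume ((ℝ ∙ twinAxis)ᗮ.reflection '' polytope topHalfHRep) = ENNReal.ofReal 16 := by
  have hmeas : MeasurableSet (polytope topHalfHRep) :=
    (Literature.Analysis.Convexity.isOpen_openHPolytope topHalfHRep).measurableSet
  rw [LinearIsometryEquiv.image_eq_preimage_symm,
    ((ℝ ∙ twinAxis)ᗮ.reflection).symm.measurePreserving.measure_preimage hmeas.nullMeasurableSet]
  exact volume_polytope_topHalfHRep

/-- `|E₀| = |T ∪ R T| = 32`. -/
theorem volume_coherentTwin :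
    volume (polytope topHalfHRep ∪ (ℝ ∙ twinAxis)ᗮ.reflection '' polytope topHalfHRep) = ENNReal.ofReal 32 := by
  have hmeas : MeasurableSet ((ℝ ∙ twinAxis)ᗮ.reflection '' polytope topHalfHRep) := by
    rw [← polytope_botHalfHRep_eq]
    exact (Literature.Analysis.Convexity.isOpen_openHPolytope botHalfHRep).measurableSet
  rw [measure_union disjoint_topHalf_reflection hmeas, volume_polytope_topHalfHRep,
    volume_reflection_topHalf, ← ENNReal.ofReal_add (by norm_num) (by norm_num)]
  norm_num

end Summit.Ventures.Crystal3D.Theorems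

end
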